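import Summits.CriticalPhenomena.PercolationContinuityZ3.Theorems.PercNearOneGluingNoHeavyLowerTailSahiSlotTensorCone

/-!
# PINNED (conditional) literal-product certificates for the slot functional: one member known exactly, the others through one cut edge each

Support file of the one-cut programme (crux `NoHeavyLowerTail`, stmt-CriticalPhenomena-4575; cell `prim-masterthm`, seat P3, gen 21;
`run/shared/lean/prim/prim-masterthm/prim-masterthm-p3/HIERARCHY.md` §29, memo `FROM-prim-masterthm-p3-g21-PINNED-CERTIFICATES.md`).

CONTEXT.  A literal-product certificate (`SahiSlot.LitProdCert d n`, gen 20) writes the slot functional `patternForm d n` on up-set families as a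
nonnegative combination of products of ONE monotonicity literal per member (Sherali–Adams level `(1,…,1)`).  It exists for `d ≤ 2` at order 3 and
NOT for any `d ≥ 3` (`litProdCert_three_iff`, gens 20–21).  The gen-21 LPs locate the minimal extra ingredient: **condition on ONE member.**
A *pinned* certificate (`SahiSlot.PinnedLitCert d n`, this file; order `n + 1`, member `0` pinned) gives, for EVERY up-set `A` of the slot cube
separately, a nonnegative combination of products of one literal per REMAINING member that equals `patternForm d (n+1) (1_A, 1_{U_1}, …, 1_{U_n})`
for all up-sets `U_1, …, U_n` — "the first member exactly, the others through single cut edges"; equivalently (order 3) the bilinear form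
`(B, C) ↦ Φ_{d,3}(A, B, C)` lies in the cone `C ⊗ C` generated by products of literals.  EVIDENCE (exact LPs, gen 21): such certificates exist for
ALL 980 up-sets of `[3]^3` (226 classes mod `S_3`, exact rational certificates, ≤ 354 terms each), for 760+ random up-sets of `[3]^4`, and — in
the Boolean / comb normal form — for every up-set of `{0,1}^m`, `m ≤ 4`, with degree-3 Bernstein-polynomial weights (exact for `m ≤ 3`), and
numerically for every up-set of `{0,1}^m`, `m ≤ 4`, under random FKG (ferromagnetic Ising) measures.  CONJECTURE (PINNED / PIVOTAL-PAIR, gen 21):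
`PinnedLitCert d 2` for every `d` — it implies `SlotPatternPos d 3` for every `d`, i.e. Sahi's `C₃` / Kahn's conjecture for all product measures
(`kahnConjecture_of_forall_slotPatternPos_three`).
THIS FILE (pure, standard axioms): the definition, its soundness `slotPatternPos_of_pinnedLitCert : PinnedLitCert d n → SlotPatternPos d (n+1)`,
and `pinnedLitCert_of_litProdCert : LitProdCert d (n+1) → PinnedLitCert d n` (a global certificate pins trivially: the pinned member's literal
values are nonnegative constants).  HONEST LABEL: a certificate FORMAT and two easy structural lemmas; no cell changes status; the instances are
LP facts recorded in the memo, not claimed here. [this work]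
-/

namespace Summit.CriticalPhenomena.PercolationContinuityZ3.Theorems

open Finset Function
open Literature.Combinatorics.Sahi2008

namespace SahiSlot

section Pinned

variable {d n : ℕ}

/-- **Pinned (conditional) literal-product certificate** at order `n + 1` in dimension `d`: for every up-set `A` of the slot cube (member `0`,
known exactly) there are finitely many products of ONE literal per remaining member, with nonnegative coefficients depending on `A`, summing to
`patternForm d (n+1) (1_A, 1_{U_1}, …, 1_{U_n})` for all up-sets `U_1, …, U_n`. [this work] [status: open for `d ≥ 4` at order 3; exact for `(3,3)`] -/
def PinnedLitCert (d n : ℕ) : Prop :=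
  ∀ A : Finset (Q d (n + 1)), IsUpperSet ((A : Finset (Q d (n + 1))) : Set (Q d (n + 1))) →
    ∃ (k : ℕ) (coef : Fin k → ℝ) (J : Fin k → Fin n → Lit d (n + 1)), (∀ j, 0 ≤ coef j) ∧
      ∀ U : Fin n → Finset (Q d (n + 1)), (∀ i, IsUpperSet ((U i : Finset (Q d (n + 1))) : Set (Q d (n + 1)))) →
        patternForm d (n + 1) (Fin.cons (setInd A) (fun i => setInd (U i))) = ∑ j, coef j * ∏ i, (J j i).eval (setInd (U i))

/-- **Soundness**: a pinned certificate proves the cell `SlotPatternPos d (n+1)`. [this work] -/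
theorem slotPatternPos_of_pinnedLitCert (h : PinnedLitCert d n) : SlotPatternPos d (n + 1) := by
  intro U hU
  obtain ⟨k, coef, J, hcoef, hid⟩ := h (U 0) (hU 0)
  have hfam : (fun i => setInd (U i)) = Fin.cons (setInd (U 0)) (fun i : Fin n => setInd (U i.succ)) := by
    funext i
    refine Fin.cases ?_ (fun j => ?_) i
    · rw [Fin.cons_zero]
    · rw [Fin.cons_succ]
  rw [hfam, hid (fun i => U i.succ) fun i => hU i.succ]
  exact sum_nonneg fun j _ => mul_nonneg (hcoef j) (prod_nonneg fun i _ => Lit.eval_setInd_nonneg _ (hU i.succ) _)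

/-- **A global literal-product certificate pins**: `LitProdCert d (n+1) → PinnedLitCert d n` — absorb the pinned member's (nonnegative, constant)
literal value into the coefficient. [this work] -/
theorem pinnedLitCert_of_litProdCert (h : LitProdCert d (n + 1)) : PinnedLitCert d n := by
  obtain ⟨k, coef, J, hcoef, hid⟩ := h
  intro A hA
  refine ⟨k, fun j => coef j * (J j 0).eval (setInd A), fun j i => J j i.succ, fun j => mul_nonneg (hcoef j) (Lit.eval_setInd_nonneg _ hA _), ?_⟩
  intro U hU
  have hup : ∀ i : Fin (n + 1), IsUpperSet (((Fin.cons A U : Fin (n + 1) → Finset (Q d (n + 1))) i : Finset (Q d (n + 1))) : Set (Q d (n + 1))) := by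
    intro i
    refine Fin.cases ?_ (fun j => ?_) i
    · rw [Fin.cons_zero]; exact hA
    · rw [Fin.cons_succ]; exact hU j
  have hfam : (Fin.cons (setInd A) (fun i => setInd (U i)) : Fin (n + 1) → Q d (n + 1) → ℝ) =
      fun i => setInd ((Fin.cons A U : Fin (n + 1) → Finset (Q d (n + 1))) i) := by
    funext i
    refine Fin.cases ?_ (fun j => ?_) i
    · rw [Fin.cons_zero, Fin.cons_zero]
    · rw [Fin.cons_succ, Fin.cons_succ]
  rw [hfam, hid _ hup]
  refine sum_congr rfl fun j _ => ?_
  rw [Fin.prod_univ_succ, Fin.cons_zero]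
  simp only [Fin.cons_succ]
  ring

/-- At order 3 in dimension `d ≤ 2` pinned certificates exist (from the global ones of gen 20 — nothing new; recorded for the table). [this work] -/
theorem pinnedLitCert_two_of_litProdCert (h : LitProdCert d 3) : PinnedLitCert d 2 := pinnedLitCert_of_litProdCert h

end Pinned

end SahiSlot

end Summit.CriticalPhenomena.PercolationContinuityZ3.Theorems
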